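import Mathlib
import Summits.NavierStokesRegularity.NavierStokesRegularity.Theorems.FilamentSkeletonRssClause13LowSliceForm

/-!
# Clause 13-J/13-R, brick B4 (S0 BOTTOM): the low-slice gain WITHOUT a lower frequency cut, and the uncertainty bound
# `∫_{|z|√q<a} |Ŷ|² ≤ (2a/√q)·‖Y‖₁² ≤ (2a/√q)·2R·‖Y‖₂²` for ball-supported `Y`

Route `FilamentSkeletonRss`, ∃-side clause 13 (`Clause13RNearStraightL` stmt-NavierStokesRegularity-23612; typing-agnostic); design of record
`filament-plan/DESIGN-NOTE-28296-tenure-g22.md` §2/§5: the low regime starts at the BALL'S LOWEST MODE `k ≈ c₁/R` ("Poincaré on the ball"); below it a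
ball-supported variation carries little spectral mass.  The landed low-slice gain `modelSelfForm_re_le_of_lowSlice` (p672737) assumes the transform
vanishes for `|z|√q < a`; a frequency cut-off (`…Clause13CutoffCommutator`) can impose the UPPER cut `|z|√q ≤ 1/10` but never a sharp lower cut on a
compactly supported `Y`.  This file removes the lower cut:

* §1 `liaSym_nonpos_of_abs_le` — `𝔖(x) ≤ 0` on `|x| ≤ 1/10` (so the bottom only helps the sign);
* §2 `spectralForm_le_of_lowSlice_top` / `modelSelfForm_re_le_of_lowSlice_top` — for `f ∈ L¹ ∩ L²` with `f̂ = 0` on `|z|√q > 1/10` and any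
  `0 < a ≤ 1/10`:  `Re 𝔔_ℂ(f) ≤ −(2/q)(a²/4)log(1/a)·(∫‖f‖² − (1/2π)∫_{|z|√q<a}|f̂|²)`;
* §3 `norm_unnormalisedTransform_le_integral_norm` (`|f̂(z)| ≤ ‖f‖₁`), `setIntegral_bottom_normSq_le` (`∫_{|z|√q<a}|f̂|² ≤ (2a/√q)‖f‖₁²`),
  `integral_norm_le_sqrt_mul_of_support` (`‖f‖₁ ≤ √(2R)·‖f‖₂` when `f = 0` off `[c−R, c+R]`) — together: the bottom costs at most
  `(2a/√q)·2R·‖f‖₂²`, i.e. a RELATIVE loss `≤ a·4R/(2π√q)` of the gain, small once `a ≲ √q/R` (= the ball scale, as the note says).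
Lane ns-filament-19175-p1 g16; `--supports stmt-NavierStokesRegularity-23612 --as helper`.
HONEST FRAMING: inequalities about an explicit 1-D model operator attached to a HYPOTHETICAL filament skeleton on the NEGATIVE side of a MODEL route;
nothing here bears on Navier–Stokes regularity or blow-up.
-/

noncomputable section

open MeasureTheory Real Complex Filter Set
open scoped FourierTransform ComplexConjugate Topology
open Summit.NavierStokesRegularity.NavierStokesRegularity.Theorems.AnalyticStripLiaSymbol (liaSym liaSym_neg liaSym_zero)

namespace Summit.NavierStokesRegularity.NavierStokesRegularity.Theorems.MatchedKernel
set_option linter.dupNamespace false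

/-! ## §1 The symbol is nonpositive on the whole low range -/

/-- `𝔖(x) ≤ 0` for `|x| ≤ 1/10`. [folklore] -/
theorem liaSym_nonpos_of_abs_le {x : ℝ} (hx : |x| ≤ 1 / 10) : liaSym x ≤ 0 := by
  by_cases h0 : x = 0
  · rw [h0, liaSym_zero]
  · have hpos : 0 < |x| := abs_pos.2 h0
    have h := liaSym_le_of_mem_lowSlice hpos le_rfl hx
    have hlog : Real.log |x| < 0 := Real.log_neg hpos (by linarith)
    exact h.trans (mul_nonpos_of_nonneg_of_nonpos (by positivity) hlog.le)

/-! ## §2 The low-slice gain with an upper cut only -/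

/-- **LOW-SLICE SPECTRAL BOUND, upper cut only.**  For `f ∈ L¹ ∩ L²` whose un-normalised transform `F(z) = ∫f e^{izx}` vanishes for
`|z|√q > 1/10`, and any `0 < a ≤ 1/10`:
`(1/2π)∫(2/q)𝔖(z√q)|F|² ≤ (2/q)(a²/4)(log a)·((1/2π)∫|F|² − (1/2π)∫_{|z|√q<a}|F|²)`. [folklore] -/
theorem spectralForm_le_of_lowSlice_top {q a : ℝ} (hq : 0 < q) (ha : 0 < a) (ha' : a ≤ 1 / 10) {f : ℝ → ℂ}
    (hf : Integrable f) (hf2 : MemLp f 2)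
    (hsupp : ∀ z : ℝ, 1 / 10 < |z| * √q → ∫ x : ℝ, f x * cexp (I * z * x) = 0) :
    1 / (2 * π) * ∫ z : ℝ, (2 / q * liaSym (z * √q)) * ‖∫ x : ℝ, f x * cexp (I * z * x)‖ ^ 2
      ≤ 2 / q * (a ^ 2 / 4 * Real.log a) *
          (1 / (2 * π) * (∫ z : ℝ, ‖∫ x : ℝ, f x * cexp (I * z * x)‖ ^ 2)
            - 1 / (2 * π) * ∫ z in {z : ℝ | |z| * √q < a}, ‖∫ x : ℝ, f x * cexp (I * z * x)‖ ^ 2) := by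
  set F : ℝ → ℂ := fun z => ∫ x : ℝ, f x * cexp (I * z * x) with hFdef
  have hsq : 0 < √q := Real.sqrt_pos.2 hq
  set S : Set ℝ := {z : ℝ | |z| * √q < a} with hSdef
  have hSm : MeasurableSet S := by
    rw [hSdef]
    exact measurableSet_lt (continuous_abs.measurable.mul_const _) measurable_const
  set κ : ℝ := 2 / q * (a ^ 2 / 4 * Real.log a) with hκ
  have hloga : Real.log a < 0 := Real.log_neg ha (by linarith)
  have hκneg : κ ≤ 0 := by
    rw [hκ]
    have : a ^ 2 / 4 * Real.log a ≤ 0 := mul_nonpos_of_nonneg_of_nonpos (by positivity) hloga.le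
    exact mul_nonpos_of_nonneg_of_nonpos (by positivity) this
  -- pointwise: `(2/q)𝔖(z√q)|F z|² ≤ κ·(1_{Sᶜ} |F z|²)`
  have hpt : ∀ z : ℝ, (2 / q * liaSym (z * √q)) * ‖F z‖ ^ 2 ≤ κ * Sᶜ.indicator (fun z => ‖F z‖ ^ 2) z := by
    intro z
    by_cases hzS : z ∈ S
    · -- bottom: symbol ≤ 0, indicator 0
      have hx : |z * √q| ≤ 1 / 10 := by
        rw [abs_mul, abs_of_pos hsq]
        have : |z| * √q < a := hzS
        linarith
      rw [Set.indicator_of_notMem (by simpa using hzS), mul_zero]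
      exact mul_nonpos_of_nonpos_of_nonneg (mul_nonpos_of_nonneg_of_nonpos (by positivity) (liaSym_nonpos_of_abs_le hx))
        (by positivity)
    · rw [Set.indicator_of_mem (Set.mem_compl hzS)]
      have hza : a ≤ |z| * √q := by
        have : ¬ (|z| * √q < a) := hzS
        exact not_lt.1 this
      by_cases hz10 : |z| * √q ≤ 1 / 10
      · have hx : a ≤ |z * √q| := by rw [abs_mul, abs_of_pos hsq]; exact hza
        have hx' : |z * √q| ≤ 1 / 10 := by rw [abs_mul, abs_of_pos hsq]; exact hz10
        exact mul_le_mul_of_nonneg_right (mul_le_mul_of_nonneg_left (liaSym_le_of_mem_lowSlice ha hx hx') (by positivity))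
          (by positivity)
      · have hF0 : F z = 0 := hsupp z (not_le.1 hz10)
        simp [hF0]
  have hI2 : Integrable (fun z : ℝ => ‖F z‖ ^ 2) := integrable_norm_sq_unnormalisedTransform hf hf2
  have hIind : Integrable (Sᶜ.indicator fun z : ℝ => ‖F z‖ ^ 2) := hI2.indicator hSm.compl
  have hIl : Integrable (fun z : ℝ => (2 / q * liaSym (z * √q)) * ‖F z‖ ^ 2) := by
    refine hI2.bdd_mul (c := 2 / q * 4) ?_ (Eventually.of_forall fun z => ?_)
    · exact ((continuous_const.mul (continuous_liaSym.comp (continuous_id.mul continuous_const))).aestronglyMeasurable)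
    · rw [Real.norm_eq_abs, abs_mul, abs_of_pos (by positivity : (0:ℝ) < 2 / q)]
      exact mul_le_mul_of_nonneg_left (abs_liaSym_le_four _) (by positivity)
  have hmono : ∫ z : ℝ, (2 / q * liaSym (z * √q)) * ‖F z‖ ^ 2 ≤ ∫ z : ℝ, κ * Sᶜ.indicator (fun z => ‖F z‖ ^ 2) z :=
    integral_mono hIl (hIind.const_mul κ) hpt
  rw [integral_const_mul, integral_indicator hSm.compl] at hmono
  -- `∫_{Sᶜ} = ∫ − ∫_S`
  have hsplit : ∫ z in Sᶜ, ‖F z‖ ^ 2 = (∫ z : ℝ, ‖F z‖ ^ 2) - ∫ z in S, ‖F z‖ ^ 2 := by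
    rw [← integral_add_compl hSm hI2]
    ring
  rw [hsplit] at hmono
  have hpos : (0 : ℝ) < 1 / (2 * π) := by positivity
  calc 1 / (2 * π) * ∫ z : ℝ, (2 / q * liaSym (z * √q)) * ‖F z‖ ^ 2
      ≤ 1 / (2 * π) * (κ * ((∫ z : ℝ, ‖F z‖ ^ 2) - ∫ z in S, ‖F z‖ ^ 2)) := mul_le_mul_of_nonneg_left hmono hpos.le
    _ = κ * (1 / (2 * π) * (∫ z : ℝ, ‖F z‖ ^ 2) - 1 / (2 * π) * ∫ z in S, ‖F z‖ ^ 2) := by ring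

/-- **LOW-SLICE GAIN for the model self form, upper cut only**: for `f ∈ L¹ ∩ L²` with `f̂ = 0` on `|z|√q > 1/10` and `0 < a ≤ 1/10`,
`Re[(2/q)∫conj f·f − ∫∫K_q(t−u)f(u)conj f(t)] ≤ −(2/q)(a²/4)log(1/a)·(∫‖f‖² − (1/2π)∫_{|z|√q<a}|f̂|²)`. [folklore] -/
theorem modelSelfForm_re_le_of_lowSlice_top {q a : ℝ} (hq : 0 < q) (ha : 0 < a) (ha' : a ≤ 1 / 10) {f : ℝ → ℂ}
    (hf : Integrable f) (hf2 : MemLp f 2)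
    (hsupp : ∀ z : ℝ, 1 / 10 < |z| * √q → ∫ x : ℝ, f x * cexp (I * z * x) = 0) :
    ((2 / q : ℂ) * (∫ t : ℝ, conj (f t) * f t)
      - ∫ t : ℝ, ∫ u : ℝ, ((((2 * q - (t - u) ^ 2) * (((t - u) ^ 2 + q) ^ (5 / 2 : ℝ))⁻¹ : ℝ)) : ℂ) * f u * conj (f t)).re
      ≤ -(2 / q * (a ^ 2 / 4) * Real.log (1 / a)) *
          ((∫ t : ℝ, ‖f t‖ ^ 2) - 1 / (2 * π) * ∫ z in {z : ℝ | |z| * √q < a}, ‖∫ x : ℝ, f x * cexp (I * z * x)‖ ^ 2) := by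
  rw [modelSelfForm_eq_spectral hq hf hf2, Complex.ofReal_re, one_div a, Real.log_inv]
  have h := spectralForm_le_of_lowSlice_top hq ha ha' hf hf2 hsupp
  have hplanch : 1 / (2 * π) * ∫ z : ℝ, ‖∫ x : ℝ, f x * cexp (I * z * x)‖ ^ 2 = ∫ t : ℝ, ‖f t‖ ^ 2 := by
    rw [← Literature.Analysis.FunctionSpaces.integral_norm_sq_fourierIntegral_eq hf hf2, integral_norm_sq_fourier_eq_unnormalised]
  calc 1 / (2 * π) * ∫ z : ℝ, 2 / q * liaSym (z * √q) * ‖∫ x : ℝ, f x * cexp (I * ↑z * ↑x)‖ ^ 2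
      ≤ 2 / q * (a ^ 2 / 4 * Real.log a) *
          (1 / (2 * π) * (∫ z : ℝ, ‖∫ x : ℝ, f x * cexp (I * z * x)‖ ^ 2)
            - 1 / (2 * π) * ∫ z in {z : ℝ | |z| * √q < a}, ‖∫ x : ℝ, f x * cexp (I * z * x)‖ ^ 2) := h
    _ = -(2 / q * (a ^ 2 / 4) * -Real.log a) *
          ((∫ t : ℝ, ‖f t‖ ^ 2) - 1 / (2 * π) * ∫ z in {z : ℝ | |z| * √q < a}, ‖∫ x : ℝ, f x * cexp (I * z * x)‖ ^ 2) := by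
        rw [hplanch]; ring

/-! ## §3 The bottom costs `≤ (2a/√q)·‖f‖₁² ≤ (2a/√q)·2R·‖f‖₂²` -/

/-- `|f̂(z)| ≤ ‖f‖₁` for the un-normalised transform. [folklore] -/
theorem norm_unnormalisedTransform_le_integral_norm (f : ℝ → ℂ) (z : ℝ) :
    ‖∫ x : ℝ, f x * cexp (I * z * x)‖ ≤ ∫ x : ℝ, ‖f x‖ := by
  refine (norm_integral_le_integral_norm _).trans (le_of_eq ?_)
  refine integral_congr_ae (Eventually.of_forall fun x => ?_)
  simp only
  rw [norm_mul, show I * (z : ℂ) * (x : ℂ) = ((z * x : ℝ) : ℂ) * I by push_cast; ring, Complex.norm_exp_ofReal_mul_I, mul_one]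

/-- **The bottom of the spectrum**: `∫_{|z|√q<a} |f̂(z)|² dz ≤ (2a/√q)·(∫‖f‖)²`. [folklore] -/
theorem setIntegral_bottom_normSq_le {q a : ℝ} (hq : 0 < q) (ha : 0 < a) (f : ℝ → ℂ) :
    ∫ z in {z : ℝ | |z| * √q < a}, ‖∫ x : ℝ, f x * cexp (I * z * x)‖ ^ 2 ≤ 2 * a / √q * (∫ x : ℝ, ‖f x‖) ^ 2 := by
  have hsq : 0 < √q := Real.sqrt_pos.2 hq
  have hS : {z : ℝ | |z| * √q < a} = Set.Ioo (-(a / √q)) (a / √q) := by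
    ext z
    rw [Set.mem_setOf_eq, Set.mem_Ioo, ← lt_div_iff₀ hsq, abs_lt]
  rw [hS]
  have hbd : ∀ z ∈ Set.Ioo (-(a / √q)) (a / √q), ‖∫ x : ℝ, f x * cexp (I * z * x)‖ ^ 2 ≤ (∫ x : ℝ, ‖f x‖) ^ 2 := by
    intro z _
    have h0 : 0 ≤ ‖∫ x : ℝ, f x * cexp (I * z * x)‖ := norm_nonneg _
    exact pow_le_pow_left₀ h0 (norm_unnormalisedTransform_le_integral_norm f z) 2
  have hvol : volume (Set.Ioo (-(a / √q)) (a / √q)) = ENNReal.ofReal (2 * a / √q) := by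
    rw [Real.volume_Ioo]
    congr 1
    ring
  have h := norm_setIntegral_le_of_norm_le_const (μ := volume) (s := Set.Ioo (-(a / √q)) (a / √q))
    (f := fun z : ℝ => ‖∫ x : ℝ, f x * cexp (I * z * x)‖ ^ 2) (C := (∫ x : ℝ, ‖f x‖) ^ 2)
    (by rw [hvol]; exact ENNReal.ofReal_lt_top) (fun z hz => by
      rw [Real.norm_eq_abs, abs_of_nonneg (by positivity)]; exact hbd z hz)
  rw [measureReal_def, hvol, ENNReal.toReal_ofReal (by positivity)] at h
  have hnn : 0 ≤ ∫ z in Set.Ioo (-(a / √q)) (a / √q), ‖∫ x : ℝ, f x * cexp (I * z * x)‖ ^ 2 :=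
    integral_nonneg fun z => by positivity
  rw [Real.norm_eq_abs, abs_of_nonneg hnn] at h
  linarith

/-- **`‖f‖₁ ≤ √(2R)·‖f‖₂` for `f` vanishing off `[c−R, c+R]`** (Cauchy–Schwarz against the indicator). [folklore] -/
theorem integral_norm_le_sqrt_mul_of_support {f : ℝ → ℂ} (hf2 : MemLp f 2) {c R : ℝ} (hR : 0 ≤ R)
    (hsupp : ∀ x, x ∉ Set.Icc (c - R) (c + R) → f x = 0) :
    ∫ x : ℝ, ‖f x‖ ≤ √(2 * R) * (∫ x : ℝ, ‖f x‖ ^ 2) ^ (1 / 2 : ℝ) := by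
  set S : Set ℝ := Set.Icc (c - R) (c + R) with hS
  have hSm : MeasurableSet S := measurableSet_Icc
  have hind : (fun x : ℝ => ‖f x‖) = fun x => S.indicator (fun _ => (1:ℝ)) x * ‖f x‖ := by
    ext x
    by_cases hx : x ∈ S
    · rw [Set.indicator_of_mem hx, one_mul]
    · rw [Set.indicator_of_notMem hx, hsupp x hx, norm_zero, mul_zero]
  rw [hind]
  have hvol : volume S = ENNReal.ofReal (2 * R) := by
    rw [hS, Real.volume_Icc]; congr 1; ring
  have hA' : MemLp (S.indicator fun _ : ℝ => (1:ℝ)) (ENNReal.ofReal 2) volume := by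
    rw [show ENNReal.ofReal (2:ℝ) = 2 by simp]
    exact memLp_indicator_const 2 hSm (1:ℝ) (Or.inr (by rw [hvol]; exact ENNReal.ofReal_ne_top))
  have hB' : MemLp (fun x : ℝ => ‖f x‖) (ENNReal.ofReal 2) volume := by
    rw [show ENNReal.ofReal (2:ℝ) = 2 by simp]; exact hf2.norm
  have h := integral_mul_le_Lp_mul_Lq_of_nonneg Real.HolderConjugate.two_two
    (Eventually.of_forall fun x => Set.indicator_nonneg (fun _ _ => zero_le_one) x)
    (Eventually.of_forall fun x => norm_nonneg (f x)) hA' hB'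
  simp only [Real.rpow_two] at h
  have hind2 : ∫ x : ℝ, (S.indicator (fun _ : ℝ => (1:ℝ)) x) ^ 2 = 2 * R := by
    have he : (fun x : ℝ => (S.indicator (fun _ : ℝ => (1:ℝ)) x) ^ 2) = S.indicator (fun _ => (1:ℝ)) := by
      ext x
      by_cases hx : x ∈ S
      · rw [Set.indicator_of_mem hx, one_pow]
      · rw [Set.indicator_of_notMem hx]; ring
    rw [he, integral_indicator_const (1:ℝ) hSm, measureReal_def, hvol, ENNReal.toReal_ofReal (by positivity), smul_eq_mul,
      mul_one]
  rw [hind2, show ((2 * R) ^ (1 / 2 : ℝ)) = √(2 * R) from (Real.sqrt_eq_rpow (2 * R)).symm] at h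
  exact h

/-- **LOW-SLICE GAIN, upper cut only, with the bottom priced in `L¹`**: for `f ∈ L¹ ∩ L²` with `f̂ = 0` on `|z|√q > 1/10` and `0 < a ≤ 1/10`,
`Re 𝔔_ℂ(f) ≤ −(2/q)(a²/4)log(1/a)·(∫‖f‖² − (1/2π)(2a/√q)(∫‖f‖)²)`.  For `f = k∗Y` with `Y` ball-supported, `‖f‖₁ ≤ ‖k‖₁√(2R)‖Y‖₂`
(`integral_norm_le_sqrt_mul_of_support`), so the bottom costs the fraction `2a·R‖k‖₁²·(‖Y‖₂/‖f‖₂)²/(π√q)` of the gain. [folklore] -/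
theorem modelSelfForm_re_le_of_lowSlice_top' {q a : ℝ} (hq : 0 < q) (ha : 0 < a) (ha' : a ≤ 1 / 10) {f : ℝ → ℂ}
    (hf : Integrable f) (hf2 : MemLp f 2)
    (hsupp : ∀ z : ℝ, 1 / 10 < |z| * √q → ∫ x : ℝ, f x * cexp (I * z * x) = 0) :
    ((2 / q : ℂ) * (∫ t : ℝ, conj (f t) * f t)
      - ∫ t : ℝ, ∫ u : ℝ, ((((2 * q - (t - u) ^ 2) * (((t - u) ^ 2 + q) ^ (5 / 2 : ℝ))⁻¹ : ℝ)) : ℂ) * f u * conj (f t)).re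
      ≤ -(2 / q * (a ^ 2 / 4) * Real.log (1 / a)) *
          ((∫ t : ℝ, ‖f t‖ ^ 2) - 1 / (2 * π) * (2 * a / √q * (∫ x : ℝ, ‖f x‖) ^ 2)) := by
  have h := modelSelfForm_re_le_of_lowSlice_top hq ha ha' hf hf2 hsupp
  have hb := setIntegral_bottom_normSq_le hq ha f
  have hgain : 0 ≤ 2 / q * (a ^ 2 / 4) * Real.log (1 / a) := by
    have hlog : 0 ≤ Real.log (1 / a) := Real.log_nonneg (by rw [le_div_iff₀ ha]; linarith)
    positivity
  refine h.trans ?_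
  have hπ : (0:ℝ) < 1 / (2 * π) := by positivity
  nlinarith [mul_le_mul_of_nonneg_left hb hπ.le]

end Summit.NavierStokesRegularity.NavierStokesRegularity.Theorems.MatchedKernel

end
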